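import Summits.HodgeConjecture.CorCM.IrreducibleOddWeightsDRank
import Summits.HodgeConjecture.CorCM.IrreducibleOddWeightsRestrictionCMFields
import Literature.AlgebraicGeometry.Pohlmann1968.CMFamilyRankSubfamilies
import HarnessLib

/-!
# CM fields with irreducible odd weights: the Mumford–Tate group of a product is that of ANY maximal nondegenerate
# sub-product; for one field, `dim Hg(∏ A_i) = n·t`

COR-CM (cell `pub-hodgecm2`, binder seat `b16` gen 56, count-neutral claim MAX-NONDEG (D-RANK), file F5 — CM dress of
F2/F3 `CorCM/IrreducibleOddWeights{MaximalAdditive,DRank}` for the action of `Aut(ℂ)` on `⊔_i Hom(K_i, ℂ)`; theorems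
only, no definition, no named fact, no `sorry`).  NEW as stated, hence under `Summits/`.  HONEST FRAMING: "rank of a
family of CM types for NAMED classes of fields" (kernel, unconditional), for INT-4 «what is known»; `HC_CM` is neither
used nor asserted.

(IRR) for a CM field `K`: the `ρ`-odd rational weights on `Hom(K, ℂ)` are an IRREDUCIBLE `Aut(ℂ)`-module (seat gens
54–55: (SC) ⟹ (IRR); every CM type of an (IRR) field is nondegenerate and every abelian variety with CM by it is
simple).  `rank(Φ) = cmFamilyRank Φ = dim MT(∏_i A_i)` for realisations `A_i` of `(K_i, Φ_i)`; a sub-collection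
`T ⊆ I` is NONDEGENERATE when `(Φ_i)_{i∈T}` is a nondegenerate family (`Hg(∏_T A_i) = ∏_T Hg(A_i)` of dimension
`Σ_T dim A_i`; then the Hodge conjecture holds on all products of the `A_i`, `i ∈ T` — tree
`IsNondegenerateFamily.hodgeConjectureFor_prod`) and MAXIMAL nondegenerate when no `i₀ ∉ T` can be added.

* §1 `forall_map_slotExt_le_iff_isNondegenerateFamily` — bookkeeping: for nondegenerate members, "additive" (the
  abstract files) IS "nondegenerate family" (the CM files).
* §2 **SEVERAL (IRR) FIELDS** (any mixture of fields and degrees):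
  **`cmFamilyRank_eq_sum_of_maximal`** — for EVERY maximal nondegenerate `T`: `rank(Φ) = Σ_{i∈T} [K_i:ℚ]/2 + 1`,
  i.e. `dim MT(∏_I A_i) = dim MT(∏_T A_i) = Σ_{i∈T} dim A_i + 1` (**`cmFamilyRank_eq_cmFamilyRank_restrict_of_maximal`**:
  the sub-product already has the Mumford–Tate group of the product, up to isogeny); `exists_maximal_isNondegenerateFamily`
  (such `T` exist); hence ALL maximal nondegenerate sub-collections have the same total dimension — the subset `T` of
  seat gen 55's subset-sum theorem (`IrreducibleOddWeightsRankSubsetSumCMFields`) is ANY maximal nondegenerate one.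
* §3 **ONE (IRR) FIELD `K` OF DEGREE `2n`**: **`cmFamilyRank_eq_card_mul_of_maximal`** — `rank(Φ) = |T|·n + 1` for
  every maximal nondegenerate `T`, i.e. `dim Hg(A_1 × ⋯ × A_k) = n·t` with `t` the common size of the maximal
  nondegenerate sub-collections (`card_eq_card_of_maximal`) = the LARGEST number of the `A_i` forming a nondegenerate
  family (`card_le_card_of_isNondegenerateFamily`) — the `D`-rank of the type vectors over the commutant of the odd
  weights (seat gen 55 card «What remains»: `dim U(Σ) = n · rank_D`); the multiplier `r` of
  `exists_cmFamilyRank_eq_mul_of_irreducible` is this `t`.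
* §4 Hodge dress: on the products over a maximal nondegenerate `T` the Hodge conjecture holds with `B• = D•`
  (`hodgeConjectureFor_prod_of_maximal`, tree); adjoining ANY further simple non-isogenous factor produces an
  exceptional Hodge class on some product (`exists_exceptional_prod_insert_of_maximal`).

## References

* [Mai1989] L. Mai, *Lower bounds for the ranks of CM types*, J. Number Theory 32 (1989), §2 Prop. 1 (proof).
* [Gordon1999HodgeAVSurvey] B. B. Gordon, *A survey of the Hodge conjecture for abelian varieties*, §3 Theorem (proof),
  7.5–7.7, 9.1, 10.10.
* [MoonenZarhin1999LowDim] B. Moonen, Yu. Zarhin, *Hodge classes on abelian varieties of low dimension*, Math. Ann.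
  315 (1999), §3 (3.1).
* [Deligne1982HodgeCycles] P. Deligne, *Hodge cycles on abelian varieties*, LNM 900 (1982), I Ex. 3.7 (c).
-/

set_option autoImplicit false

noncomputable section

open scoped BigOperators

open CategoryTheory CategoryTheory.Limits NumberField

namespace Summit.HodgeConjecture.CorCM

open Literature.NumberTheory.ComplexMultiplication
open Literature.AlgebraicGeometry.Motives (AbelianVariety CMType)
open Literature.AlgebraicGeometry.HodgeTheory
open Literature.AlgebraicGeometry.ComplexMultiplication (IsCMTypeRealisation)
open Literature.AlgebraicGeometry.Pohlmann1968
open Literature.AlgebraicGeometry.VanGeemen1994 (hodgeClassSpan)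
open Literature.Barriers.HodgeConjecture (divisorClassesSpan)
open GenericCMField

/-! ## §1 Bookkeeping: additive = nondegenerate family, for nondegenerate members -/

section Bookkeeping

variable {J : Type} [Fintype J] [DecidableEq J] {K : J → Type} [∀ j, Field (K j)] [∀ j, NumberField (K j)]
  [∀ j, IsCMField (K j)]

/-- **For nondegenerate members, "additive" ⟺ "nondegenerate family"** (`ext_j U(Φ_j) ≤ U(Σ)` for all `j` ⟺
`rank(Φ) = Σ_j [K_j:ℚ]/2 + 1`). [cite: Gordon1999HodgeAVSurvey, 7.5–7.6] -/
theorem forall_map_slotExt_le_iff_isNondegenerateFamily [Nonempty J] (Φ : ∀ j, CMType (K j))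
    (hnd : ∀ j, IsNondegenerate (Φ j)) :
    (∀ j, (antiSpan (ℂ ≃+* ℂ) (Φ j).1).map (slotExt (E := fun j => K j →+* ℂ) j) ≤
        antiSpan (ℂ ≃+* ℂ) (sigmaType fun j => (Φ j).1)) ↔ CMAlgebra.IsNondegenerateFamily Φ := by
  rw [CMAlgebra.isNondegenerateFamily_iff]
  change _ ↔ typeRank (ℂ ≃+* ℂ) (sigmaType fun j => (Φ j).1) = _
  rw [forall_map_slotExt_le_iff_typeRank_sigmaType_eq (fun j => isCMTypeWith_conj (Φ j)) fun j => by
      rw [Embeddings.card (K j) ℂ]; exact (isNondegenerate_iff (Φ j)).1 (hnd j),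
    Fintype.card_sigma, Finset.sum_congr rfl fun j _ => Embeddings.card (K j) ℂ]

end Bookkeeping

/-! ## §2 Several (IRR) fields: every maximal nondegenerate sub-collection carries the Mumford–Tate group -/

section Several

variable {I : Type} [Fintype I] [DecidableEq I] {K : I → Type} [∀ i, Field (K i)] [∀ i, NumberField (K i)]
  [∀ i, IsCMField (K i)]

/-- **`rank(Φ) = Σ_{i∈T} [K_i:ℚ]/2 + 1` FOR EVERY MAXIMAL NONDEGENERATE SUB-COLLECTION `T`** of a family of CM types of
(IRR) fields (any mixture of fields and degrees): `dim MT(∏_I A_i) = Σ_{i∈T} dim A_i + 1` — the members outside `T`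
add nothing to the Mumford–Tate group.  (`T = ∅` is allowed when no member exists; for `I ≠ ∅` a maximal `T` is
nonempty since single members are nondegenerate.) [cite: Gordon1999HodgeAVSurvey, §3 Theorem (proof), 7.5–7.7 and 9.1]
[cite: Mai1989, §2 Prop. 1 (proof)] -/
theorem cmFamilyRank_eq_sum_of_maximal [Nonempty I]
    (hirr : ∀ i, ∀ W : Submodule ℚ ((K i →+* ℂ) → ℚ), W ≤ antiWeights (E := K i →+* ℂ) (starRingAut : ℂ ≃+* ℂ) →
      W ≠ ⊥ → (∀ (k : ℂ ≃+* ℂ) (f : (K i →+* ℂ) → ℚ), f ∈ W → (fun y => f (k • y)) ∈ W) →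
      W = antiWeights (E := K i →+* ℂ) (starRingAut : ℂ ≃+* ℂ))
    (Φ : ∀ i, CMType (K i)) (T : Finset I)
    (hT : T = ∅ ∨ CMAlgebra.IsNondegenerateFamily (fun j : T => Φ j.1))
    (hmax : ∀ i₀, i₀ ∉ T → ¬ CMAlgebra.IsNondegenerateFamily (fun j : ↥(insert i₀ T) => Φ j.1)) :
    CMAlgebra.cmFamilyRank Φ = (∑ i ∈ T, Module.finrank ℚ (K i) / 2) + 1 := by
  classical
  obtain ⟨i₁⟩ := ‹Nonempty I›
  obtain ⟨s₁⟩ : Nonempty (K i₁ →+* ℂ) := inferInstance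
  haveI : Nonempty (Σ i, (K i →+* ℂ)) := ⟨⟨i₁, s₁⟩⟩
  have hnd : ∀ i, IsNondegenerate (Φ i) := fun i => isNondegenerate_of_irreducible (hirr i) (Φ i)
  -- additivity of the sub-family `T`
  have hadd : ∀ j : {i // i ∈ T}, (antiSpan (ℂ ≃+* ℂ) (Φ j.1).1).map
      (slotExt (E := fun j : {i // i ∈ T} => K j.1 →+* ℂ) j) ≤
        antiSpan (ℂ ≃+* ℂ) (sigmaType fun j : {i // i ∈ T} => (Φ j.1).1) := by
    rcases hT with rfl | hT
    · exact fun j => absurd j.2 (Finset.notMem_empty _)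
    · intro j
      haveI : Nonempty (T : Type) := ⟨j⟩
      exact (forall_map_slotExt_le_iff_isNondegenerateFamily (fun j : T => Φ j.1) fun j => hnd j.1).2 hT j
  -- maximality in the additive form
  have hmax' : ∀ i₀, i₀ ∉ T → ¬ ∀ j : {i // i ∈ T ∨ i = i₀}, (antiSpan (ℂ ≃+* ℂ) (Φ j.1).1).map
      (slotExt (E := fun j : {i // i ∈ T ∨ i = i₀} => K j.1 →+* ℂ) j) ≤
        antiSpan (ℂ ≃+* ℂ) (sigmaType fun j : {i // i ∈ T ∨ i = i₀} => (Φ j.1).1) := by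
    intro i₀ hi₀ hadd'
    haveI : Nonempty (↥(insert i₀ T) : Type) := ⟨⟨i₀, Finset.mem_insert_self i₀ T⟩⟩
    refine hmax i₀ hi₀ ((forall_map_slotExt_le_iff_isNondegenerateFamily
      (fun j : ↥(insert i₀ T) => Φ j.1) fun j => hnd j.1).1 ?_)
    exact IrrOdd.forall_map_slotExt_le_congr (E := fun i => K i →+* ℂ) (fun i => (Φ i).1)
      (fun i => by rw [Finset.mem_insert]; exact Or.comm) hadd'
  -- F2 and the members' ranks
  change typeRank (ℂ ≃+* ℂ) (sigmaType fun i => (Φ i).1) = _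
  rw [(IsCMTypeWith.sigmaType fun i => isCMTypeWith_conj (Φ i)).typeRank_eq_finrank_antiSpan_add_one,
    IrrOdd.finrank_antiSpan_sigmaType_eq_sum_of_maximal (E := fun i => K i →+* ℂ) (fun i => (Φ i).1) T
      (fun i _ => IrrOdd.antiSpan_irreducible_of_irreducible (isCMTypeWith_conj (Φ i)) (hirr i)) hadd hmax',
    Finset.sum_congr rfl fun i _ => by
      rw [finrank_antiSpan_eq_of_isNondegenerate (Φ i) (hnd i)]]
where
  /-- `dim U(Φ) = [K:ℚ]/2` for a nondegenerate type. -/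
  finrank_antiSpan_eq_of_isNondegenerate {k : Type} [Field k] [NumberField k] [IsCMField k] (Ψ : CMType k)
      (h : IsNondegenerate Ψ) : Module.finrank ℚ (antiSpan (ℂ ≃+* ℂ) Ψ.1) = Module.finrank ℚ k / 2 := by
    have h1 := (isNondegenerate_iff Ψ).1 h
    rw [cmTypeRank, (isCMTypeWith_conj Ψ).typeRank_eq_finrank_antiSpan_add_one, Nat.add_right_cancel_iff] at h1
    exact h1

/-- **… and `rank(Φ) = rank(Φ|_T)`**: the sub-product over a maximal nondegenerate `T` already has the
Mumford–Tate group of the whole product (up to isogeny). [cite: Gordon1999HodgeAVSurvey, 7.5–7.7 and 9.1] -/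
theorem cmFamilyRank_eq_cmFamilyRank_restrict_of_maximal [Nonempty I]
    (hirr : ∀ i, ∀ W : Submodule ℚ ((K i →+* ℂ) → ℚ), W ≤ antiWeights (E := K i →+* ℂ) (starRingAut : ℂ ≃+* ℂ) →
      W ≠ ⊥ → (∀ (k : ℂ ≃+* ℂ) (f : (K i →+* ℂ) → ℚ), f ∈ W → (fun y => f (k • y)) ∈ W) →
      W = antiWeights (E := K i →+* ℂ) (starRingAut : ℂ ≃+* ℂ))
    (Φ : ∀ i, CMType (K i)) (T : Finset I)
    (hT : CMAlgebra.IsNondegenerateFamily (fun j : T => Φ j.1))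
    (hmax : ∀ i₀, i₀ ∉ T → ¬ CMAlgebra.IsNondegenerateFamily (fun j : ↥(insert i₀ T) => Φ j.1)) :
    CMAlgebra.cmFamilyRank Φ = CMAlgebra.cmFamilyRank (fun j : T => Φ j.1) := by
  rw [cmFamilyRank_eq_sum_of_maximal hirr Φ T (Or.inr hT) hmax, (CMAlgebra.isNondegenerateFamily_iff _).1 hT]
  congr 1
  rw [← Nat.sum_div fun i _ => two_dvd_finrank (Φ i)]
  congr 1
  exact (Finset.sum_coe_sort T fun i => Module.finrank ℚ (K i)).symm
where
  /-- `2 ∣ [k:ℚ]` for a CM field carrying a CM type. -/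
  two_dvd_finrank {k : Type} [Field k] [NumberField k] [IsCMField k] (Ψ : CMType k) : 2 ∣ Module.finrank ℚ k := by
    rw [← Embeddings.card k ℂ]
    exact (isCMTypeWith_conj Ψ).two_dvd_card

/-- **Maximal nondegenerate sub-collections exist** (for `I ≠ ∅`; single members of (IRR) fields are nondegenerate).
[cite: Gordon1999HodgeAVSurvey, 7.5–7.6] -/
theorem exists_maximal_isNondegenerateFamily [Nonempty I]
    (hirr : ∀ i, ∀ W : Submodule ℚ ((K i →+* ℂ) → ℚ), W ≤ antiWeights (E := K i →+* ℂ) (starRingAut : ℂ ≃+* ℂ) →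
      W ≠ ⊥ → (∀ (k : ℂ ≃+* ℂ) (f : (K i →+* ℂ) → ℚ), f ∈ W → (fun y => f (k • y)) ∈ W) →
      W = antiWeights (E := K i →+* ℂ) (starRingAut : ℂ ≃+* ℂ))
    (Φ : ∀ i, CMType (K i)) :
    ∃ T : Finset I, T.Nonempty ∧ CMAlgebra.IsNondegenerateFamily (fun j : T => Φ j.1) ∧
      ∀ i₀, i₀ ∉ T → ¬ CMAlgebra.IsNondegenerateFamily (fun j : ↥(insert i₀ T) => Φ j.1) := by
  classical
  let S : Finset (Finset I) := Finset.univ.filter fun T =>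
    T.Nonempty ∧ CMAlgebra.IsNondegenerateFamily (fun j : T => Φ j.1)
  obtain ⟨i₁⟩ := ‹Nonempty I›
  have h1 : ({i₁} : Finset I) ∈ S := by
    rw [Finset.mem_filter]
    refine ⟨Finset.mem_univ _, Finset.singleton_nonempty _, ?_⟩
    haveI : Nonempty (↥({i₁} : Finset I) : Type) := ⟨⟨i₁, Finset.mem_singleton_self _⟩⟩
    refine (forall_map_slotExt_le_iff_isNondegenerateFamily (fun j : ({i₁} : Finset I) => Φ j.1)
      fun j => isNondegenerate_of_irreducible (hirr j.1) (Φ j.1)).1 fun j => ?_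
    -- a one-member family is additive (one slot is slotwise independent)
    haveI : Subsingleton (↥({i₁} : Finset I) : Type) :=
      ⟨fun a b => Subtype.ext ((Finset.mem_singleton.1 a.2).trans (Finset.mem_singleton.1 b.2).symm)⟩
    exact map_slotExt_antiSpan_le (E := fun j : ({i₁} : Finset I) => K j.1 →+* ℂ)
      (fun j => isCMTypeWith_conj (Φ j.1)) (fun i g => ⟨g, fun _ => rfl, fun j hj => (hj (Subsingleton.elim j i)).elim⟩) j
  obtain ⟨T, hTS, hTmax⟩ := Finset.exists_max_image S Finset.card ⟨_, h1⟩
  rw [Finset.mem_filter] at hTS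
  refine ⟨T, hTS.2.1, hTS.2.2, fun i₀ hi₀ hnd => ?_⟩
  have hmem : insert i₀ T ∈ S := by
    rw [Finset.mem_filter]
    exact ⟨Finset.mem_univ _, Finset.insert_nonempty _ _, hnd⟩
  have := hTmax _ hmem
  rw [Finset.card_insert_of_notMem hi₀] at this
  omega

/-- **All maximal nondegenerate sub-collections have the same total dimension `Σ_{i∈T} [K_i:ℚ]/2`** (= `dim Hg(∏_I A_i)`).
[cite: Gordon1999HodgeAVSurvey, 7.5–7.7 and 9.1] -/
theorem sum_eq_sum_of_maximal [Nonempty I]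
    (hirr : ∀ i, ∀ W : Submodule ℚ ((K i →+* ℂ) → ℚ), W ≤ antiWeights (E := K i →+* ℂ) (starRingAut : ℂ ≃+* ℂ) →
      W ≠ ⊥ → (∀ (k : ℂ ≃+* ℂ) (f : (K i →+* ℂ) → ℚ), f ∈ W → (fun y => f (k • y)) ∈ W) →
      W = antiWeights (E := K i →+* ℂ) (starRingAut : ℂ ≃+* ℂ))
    (Φ : ∀ i, CMType (K i)) (S T : Finset I)
    (hS : S = ∅ ∨ CMAlgebra.IsNondegenerateFamily (fun j : S => Φ j.1))
    (hSmax : ∀ i₀, i₀ ∉ S → ¬ CMAlgebra.IsNondegenerateFamily (fun j : ↥(insert i₀ S) => Φ j.1))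
    (hT : T = ∅ ∨ CMAlgebra.IsNondegenerateFamily (fun j : T => Φ j.1))
    (hTmax : ∀ i₀, i₀ ∉ T → ¬ CMAlgebra.IsNondegenerateFamily (fun j : ↥(insert i₀ T) => Φ j.1)) :
    ∑ i ∈ S, Module.finrank ℚ (K i) / 2 = ∑ i ∈ T, Module.finrank ℚ (K i) / 2 := by
  have h := (cmFamilyRank_eq_sum_of_maximal hirr Φ S hS hSmax).symm.trans
    (cmFamilyRank_eq_sum_of_maximal hirr Φ T hT hTmax)
  omega

end Several

/-! ## §3 One (IRR) field of degree `2n`: `rank(Φ) = |T|·n + 1` -/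

section One

variable {K : Type} [Field K] [NumberField K] [IsCMField K] {I : Type} [Fintype I] [DecidableEq I] [Nonempty I]

/-- **ONE (IRR) FIELD OF DEGREE `2n`: `rank(Φ) = |T|·n + 1` for EVERY maximal nondegenerate sub-collection `T`** —
`dim Hg(A_1 × ⋯ × A_k) = n·|T|` for abelian varieties with CM by `K`. [cite: Mai1989, §2 Prop. 1 (proof)]
[cite: Gordon1999HodgeAVSurvey, §3 Theorem (proof), 7.5–7.7 and 9.1] -/
theorem cmFamilyRank_eq_card_mul_of_maximal
    (hirr : ∀ W : Submodule ℚ ((K →+* ℂ) → ℚ), W ≤ antiWeights (E := K →+* ℂ) (starRingAut : ℂ ≃+* ℂ) → W ≠ ⊥ →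
      (∀ (k : ℂ ≃+* ℂ) (f : (K →+* ℂ) → ℚ), f ∈ W → (fun y => f (k • y)) ∈ W) →
      W = antiWeights (E := K →+* ℂ) (starRingAut : ℂ ≃+* ℂ))
    (Φ : I → CMType K) (T : Finset I)
    (hT : T = ∅ ∨ CMAlgebra.IsNondegenerateFamily (K := fun _ : T => K) (fun j => Φ j.1))
    (hmax : ∀ i₀, i₀ ∉ T → ¬ CMAlgebra.IsNondegenerateFamily (K := fun _ : ↥(insert i₀ T) => K) (fun j => Φ j.1)) :
    CMAlgebra.cmFamilyRank (K := fun _ : I => K) Φ = T.card * (Module.finrank ℚ K / 2) + 1 := by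
  rw [cmFamilyRank_eq_sum_of_maximal (K := fun _ : I => K) (fun _ => hirr) Φ T hT hmax, Finset.sum_const,
    smul_eq_mul]

/-- **A nondegenerate sub-collection `S` has at most `|T|` members, `T` any maximal nondegenerate one**
(`rank(Φ|_S) = |S|·n + 1 ≤ rank(Φ) = |T|·n + 1`, tree `CMAlgebra.cmFamilyRank_restrict_le`): `|T|` is the LARGEST
size of a nondegenerate sub-collection. [cite: Gordon1999HodgeAVSurvey, 7.6.1 and 7.7] -/
theorem card_le_card_of_isNondegenerateFamily
    (hirr : ∀ W : Submodule ℚ ((K →+* ℂ) → ℚ), W ≤ antiWeights (E := K →+* ℂ) (starRingAut : ℂ ≃+* ℂ) → W ≠ ⊥ →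
      (∀ (k : ℂ ≃+* ℂ) (f : (K →+* ℂ) → ℚ), f ∈ W → (fun y => f (k • y)) ∈ W) →
      W = antiWeights (E := K →+* ℂ) (starRingAut : ℂ ≃+* ℂ))
    (Φ : I → CMType K) (S T : Finset I)
    (hS : CMAlgebra.IsNondegenerateFamily (K := fun _ : S => K) (fun j => Φ j.1))
    (hT : T = ∅ ∨ CMAlgebra.IsNondegenerateFamily (K := fun _ : T => K) (fun j => Φ j.1))
    (hmax : ∀ i₀, i₀ ∉ T → ¬ CMAlgebra.IsNondegenerateFamily (K := fun _ : ↥(insert i₀ T) => K) (fun j => Φ j.1)) :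
    S.card ≤ T.card := by
  obtain ⟨i₁⟩ := ‹Nonempty I›
  have hle := CMAlgebra.cmFamilyRank_restrict_le (K := fun _ : I => K) Φ S
  rw [cmFamilyRank_eq_card_mul_of_maximal hirr Φ T hT hmax, (CMAlgebra.isNondegenerateFamily_iff _).1 hS,
    Finset.sum_const, smul_eq_mul, Finset.card_univ, Fintype.card_coe,
    Nat.mul_div_assoc _ (cmFamilyRank_eq_cmFamilyRank_restrict_of_maximal.two_dvd_finrank (Φ i₁))] at hle
  have hn : 0 < Module.finrank ℚ K / 2 := Nat.div_pos (two_le_finrank (Φ i₁)) two_pos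
  exact Nat.le_of_mul_le_mul_right (by omega) hn
where
  /-- `2 ≤ [k:ℚ]` for a CM field carrying a CM type. -/
  two_le_finrank {k : Type} [Field k] [NumberField k] [IsCMField k] (Ψ : CMType k) : 2 ≤ Module.finrank ℚ k := by
    obtain ⟨s⟩ : Nonempty (k →+* ℂ) := inferInstance
    rw [← Embeddings.card k ℂ]
    exact Fintype.one_lt_card_iff_nontrivial.2 ⟨⟨(starRingAut : ℂ ≃+* ℂ) • s, s, (isCMTypeWith_conj Ψ).rho_smul_ne s⟩⟩

/-- **All maximal nondegenerate sub-collections have the same size** `t` — the rank of the type vectors over the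
commutant of the odd weights; `dim Hg(∏ A_i) = n·t`. [cite: Mai1989, §2 Prop. 1 (proof)] [cite: Gordon1999HodgeAVSurvey, 9.1] -/
theorem card_eq_card_of_maximal
    (hirr : ∀ W : Submodule ℚ ((K →+* ℂ) → ℚ), W ≤ antiWeights (E := K →+* ℂ) (starRingAut : ℂ ≃+* ℂ) → W ≠ ⊥ →
      (∀ (k : ℂ ≃+* ℂ) (f : (K →+* ℂ) → ℚ), f ∈ W → (fun y => f (k • y)) ∈ W) →
      W = antiWeights (E := K →+* ℂ) (starRingAut : ℂ ≃+* ℂ))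
    (Φ : I → CMType K) (S T : Finset I)
    (hS : S = ∅ ∨ CMAlgebra.IsNondegenerateFamily (K := fun _ : S => K) (fun j => Φ j.1))
    (hSmax : ∀ i₀, i₀ ∉ S → ¬ CMAlgebra.IsNondegenerateFamily (K := fun _ : ↥(insert i₀ S) => K) (fun j => Φ j.1))
    (hT : T = ∅ ∨ CMAlgebra.IsNondegenerateFamily (K := fun _ : T => K) (fun j => Φ j.1))
    (hTmax : ∀ i₀, i₀ ∉ T → ¬ CMAlgebra.IsNondegenerateFamily (K := fun _ : ↥(insert i₀ T) => K) (fun j => Φ j.1)) :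
    S.card = T.card := by
  have h := (cmFamilyRank_eq_card_mul_of_maximal hirr Φ S hS hSmax).symm.trans
    (cmFamilyRank_eq_card_mul_of_maximal hirr Φ T hT hTmax)
  obtain ⟨i₁⟩ := ‹Nonempty I›
  have hn : 0 < Module.finrank ℚ K / 2 :=
    Nat.div_pos (card_le_card_of_isNondegenerateFamily.two_le_finrank (Φ i₁)) two_pos
  exact Nat.eq_of_mul_eq_mul_right hn (by omega)

/-- **Existence for one field**, in the constant-family spelling. [cite: Gordon1999HodgeAVSurvey, 7.5–7.6] -/
theorem exists_maximal_isNondegenerateFamily_one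
    (hirr : ∀ W : Submodule ℚ ((K →+* ℂ) → ℚ), W ≤ antiWeights (E := K →+* ℂ) (starRingAut : ℂ ≃+* ℂ) → W ≠ ⊥ →
      (∀ (k : ℂ ≃+* ℂ) (f : (K →+* ℂ) → ℚ), f ∈ W → (fun y => f (k • y)) ∈ W) →
      W = antiWeights (E := K →+* ℂ) (starRingAut : ℂ ≃+* ℂ))
    (Φ : I → CMType K) :
    ∃ T : Finset I, T.Nonempty ∧ CMAlgebra.IsNondegenerateFamily (K := fun _ : T => K) (fun j => Φ j.1) ∧
      (∀ i₀, i₀ ∉ T → ¬ CMAlgebra.IsNondegenerateFamily (K := fun _ : ↥(insert i₀ T) => K) (fun j => Φ j.1)) ∧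
      CMAlgebra.cmFamilyRank (K := fun _ : I => K) Φ = T.card * (Module.finrank ℚ K / 2) + 1 := by
  obtain ⟨T, hTne, hT, hmax⟩ := exists_maximal_isNondegenerateFamily (K := fun _ : I => K) (fun _ => hirr) Φ
  exact ⟨T, hTne, hT, hmax, cmFamilyRank_eq_card_mul_of_maximal hirr Φ T (Or.inr hT) hmax⟩

end One

/-! ## §4 Hodge dress -/

section Hodge

variable {I : Type} [Fintype I] [DecidableEq I] {K : I → Type} [∀ i, Field (K i)] [∀ i, NumberField (K i)]
  [∀ i, IsCMField (K i)] {Φ : ∀ i, CMType (K i)} {A : I → AbelianVariety ℂ} {ι : ∀ i, 𝓞 (K i) →+* End (A i)}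
  {θ : ∀ i, K i →+* Module.End ℂ (complexBetti (A i).X 1)}

omit [Fintype I] [DecidableEq I] in
/-- **On every product `⨁_{j<N} A_{π j}` of members of a nondegenerate sub-collection `T` the Hodge conjecture holds,
with `B• = D•`** (tree `IsNondegenerateFamily.hodgeConjectureFor_prod`, recorded for the maximal `T` of §2: these are
the largest sub-products of `∏_I A_i` decided by divisor classes). [cite: Gordon1999HodgeAVSurvey, 7.5 and 10.10] -/
theorem hodgeConjectureFor_prod_of_isNondegenerateFamily_restrict (T : Finset I) [Nonempty (T : Type)]
    (hT : CMAlgebra.IsNondegenerateFamily (fun j : T => Φ j.1))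
    (hA : ∀ i, IsCMTypeRealisation (Φ i) (A i) (ι i) (θ i)) {N : ℕ} (π : Fin N → T) :
    HodgeConjectureFor (⨁ fun j : Fin N => A (π j).1).dim (⨁ fun j : Fin N => A (π j).1).X ∧
      ∀ m : ℕ, hodgeClassSpan (⨁ fun j : Fin N => A (π j).1).dim (⨁ fun j : Fin N => A (π j).1).X m =
        divisorClassesSpan (⨁ fun j : Fin N => A (π j).1).X (⨁ fun j : Fin N => A (π j).1).dim m :=
  ⟨hT.hodgeConjectureFor_prod (A := fun j : T => A j.1) (fun j => hA j.1) π,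
    fun m => hT.hodgeClassSpan_prod_eq_divisorClassesSpan (A := fun j : T => A j.1) (fun j => hA j.1) π m⟩

omit [Fintype I] in
/-- **Adjoining one more SIMPLE, NON-ISOGENOUS factor to a maximal nondegenerate sub-collection produces an EXCEPTIONAL
Hodge class** on some product `⨁_{j<N} A_{π j}` of the enlarged collection (the enlarged family is degenerate by
maximality and separating by simplicity). [cite: Gordon1999HodgeAVSurvey, 7.5–7.7] -/
theorem exists_exceptional_prod_insert_of_maximal (T : Finset I) {i₀ : I} (hi₀ : i₀ ∉ T)
    (hmax : ∀ i, i ∉ T → ¬ CMAlgebra.IsNondegenerateFamily (fun j : ↥(insert i T) => Φ j.1))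
    (hA : ∀ i, IsCMTypeRealisation (Φ i) (A i) (ι i) (θ i)) (hs : ∀ i, (A i).IsSimple)
    (hniso : ∀ i j, i ≠ j → ¬ AbelianVariety.IsIsogenous (A i) (A j)) :
    ∃ (N : ℕ) (π : Fin N → ↥(insert i₀ T)) (m : ℕ)
      (c : complexBetti (⨁ fun j : Fin N => A (π j).1).X (2 * m)),
      IsRationalClass c ∧
      IsOfHodgeType (⨁ fun j : Fin N => A (π j).1).dim (⨁ fun j : Fin N => A (π j).1).X (2 * m) m m c ∧
      c ∉ divisorClassesSpan (⨁ fun j : Fin N => A (π j).1).X (⨁ fun j : Fin N => A (π j).1).dim m := by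
  haveI : Nonempty (↥(insert i₀ T) : Type) := ⟨⟨i₀, Finset.mem_insert_self i₀ T⟩⟩
  exact CMAlgebra.exists_exceptional_prod_of_not_isNondegenerateFamily (A := fun j : ↥(insert i₀ T) => A j.1)
    (CMAlgebra.isSeparatingFamily_of_isSimple_of_pairwise_not_isIsogenous (fun j => hA j.1) (fun j => hs j.1)
      fun j j' hjj' => hniso j.1 j'.1 fun h => hjj' (Subtype.ext h))
    (hmax i₀ hi₀) fun j => hA j.1

end Hodge

end Summit.HodgeConjecture.CorCM

end
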